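import Mathlib.Analysis.SpecialFunctions.Complex.Circle
import Mathlib.Analysis.SpecialFunctions.Trigonometric.Basic
import Mathlib.MeasureTheory.Integral.IntervalIntegral.Basic
import Literature.Analysis.Asymptotics.StepRatioRiemannSum

/-!
# Crux `AnalyticDetour` (stmt-QuantumFields-8801): positive-definite periodic kernels have
# non-negative cosine moments (Herglotz, easy direction)

Route `GronwallGap`, sub-problem `YangMills`.  The admissibility predicate `Adm` of the crux asks
every weight `w s` to be of POSITIVE TYPE on `G`:
`0 ≤ Re ∑ᵢ ∑ⱼ conj(cᵢ) cⱼ w((xᵢ)⁻¹ xⱼ)` for all finite families.  Restricted to a one-parameter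
subgroup `t : ℝ → G` this makes `k := w ∘ t` a positive-definite TRANSLATION KERNEL on `ℝ`,
`0 ≤ Re ∑ᵢ ∑ⱼ conj(cᵢ) cⱼ k(xⱼ − xᵢ)`.  This file proves the elementary half of the
Herglotz–Bochner theorem for such kernels: if `k` is continuous and `2π`-periodic then all its
cosine moments `∫₀^{2π} k(x) cos(m x) dx`, `m ∈ ℤ`, are non-negative.  Proof: test the kernel on
the `N + 1` equally spaced points `xᵢ = i h`, `h = 2π/(N+1)`, with coefficients `cᵢ = e^{i m xᵢ}`;
by periodicity the double sum regroups into `(N+1) ∑_{d ≤ N} k(d h) cos(m d h)`, a left Riemann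
sum of `k cos(m ·)` over `[0, 2π]`, which converges to the moment
(`Literature.Analysis.Asymptotics.tendsto_mul_sum_range_intervalIntegral`).

It is used in `GronwallGapAnalyticDetourNegativeAdjoint.lean` to show that the mixed
fundamental–adjoint single-plaquette weights with NEGATIVE adjoint coupling are never of positive
type.  [folklore: Herglotz 1911; Katznelson, *An Introduction to Harmonic Analysis*, I.7]
-/

noncomputable section

namespace Summit.QuantumFields.YangMills.Theorems

open scoped BigOperators
open Real Filter Topology

/-- **Regrouping a periodic double sum.**  If `F` has period `(N+1) h` then
`∑_{i,j ≤ N} F((j − i) h) = (N+1) ∑_{d ≤ N} F(d h)`: for each `i`, `j ↦ i + j (mod N+1)` is a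
bijection of `Fin (N+1)` and the wrap-around costs exactly one period. [folklore] -/
theorem sum_sum_sub_mul_eq_of_periodic {F : ℝ → ℝ} {N : ℕ} {h : ℝ}
    (hF : Function.Periodic F ((N + 1 : ℕ) * h)) :
    ∑ i : Fin (N + 1), ∑ j : Fin (N + 1), F (((j : ℕ) - (i : ℕ) : ℝ) * h) =
      ((N + 1 : ℕ) : ℝ) * ∑ d ∈ Finset.range (N + 1), F (d * h) := by
  have hrow : ∀ i : Fin (N + 1),
      ∑ j : Fin (N + 1), F (((j : ℕ) - (i : ℕ) : ℝ) * h) = ∑ d ∈ Finset.range (N + 1), F (d * h) := by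
    intro i
    rw [← Equiv.sum_comp (Equiv.addLeft i), ← Fin.sum_univ_eq_sum_range (fun d => F (d * h))]
    refine Finset.sum_congr rfl fun d _ => ?_
    simp only [Equiv.coe_addLeft, Fin.val_add]
    by_cases hlt : (i : ℕ) + (d : ℕ) < N + 1
    · rw [Nat.mod_eq_of_lt hlt]
      push_cast
      ring_nf
    · rw [not_lt] at hlt
      have hlt2 : (i : ℕ) + (d : ℕ) - (N + 1) < N + 1 := by omega
      rw [Nat.mod_eq_sub_mod hlt, Nat.mod_eq_of_lt hlt2]
      have e : (((i : ℕ) + (d : ℕ) - (N + 1) : ℕ) : ℝ) - (i : ℕ) = (d : ℕ) - ((N + 1 : ℕ) : ℝ) := by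
        rw [Nat.cast_sub hlt]
        push_cast
        ring
      rw [e, sub_mul, hF.sub_eq]
  simp only [hrow, Finset.sum_const, Finset.card_univ, Fintype.card_fin, nsmul_eq_mul]

/-- **Herglotz, easy direction.**  A continuous `2π`-periodic real kernel `k` that is positive
definite as a translation kernel on `ℝ` (`0 ≤ Re ∑ᵢ ∑ⱼ conj(cᵢ) cⱼ k(xⱼ − xᵢ)` for all finite
families of points and complex coefficients) has non-negative cosine moments:
`0 ≤ ∫₀^{2π} k(x) cos(m x) dx` for every `m ∈ ℤ`. [folklore: Herglotz 1911] -/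
theorem integral_mul_cos_nonneg_of_posDef {k : ℝ → ℝ} (hk : Continuous k)
    (hper : Function.Periodic k (2 * π))
    (hPD : ∀ (n : ℕ) (x : Fin n → ℝ) (c : Fin n → ℂ),
      0 ≤ (∑ i, ∑ j, (starRingEnd ℂ) (c i) * c j * ((k (x j - x i) : ℝ) : ℂ)).re)
    (m : ℤ) : 0 ≤ ∫ x in (0 : ℝ)..2 * π, k x * Real.cos (m * x) := by
  -- the integrand and its periodicity
  set F : ℝ → ℝ := fun u => k u * Real.cos (m * u) with hFdef
  have hFc : Continuous F := hk.mul (Real.continuous_cos.comp (continuous_const.mul continuous_id))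
  have hFper : Function.Periodic F (2 * π) := by
    intro u
    simp only [hFdef]
    rw [hper u, mul_add, show (m : ℝ) * (2 * π) = (m : ℤ) * (2 * π) by norm_cast,
      Real.cos_add_int_mul_two_pi]
  -- step `h_N = 2π/(N+1)`
  set hs : ℕ → ℝ := fun N => 2 * π / ((N + 1 : ℕ) : ℝ) with hhs
  have hhpos : ∀ N, 0 < hs N := fun N => by positivity
  have hNh : ∀ N, ((N + 1 : ℕ) : ℝ) * hs N = 2 * π := fun N => by
    rw [hhs]; field_simp
  -- every Riemann sum is non-negative (positive definiteness on equally spaced points)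
  have hRS : ∀ N : ℕ, 0 ≤ hs N * ∑ d ∈ Finset.range (N + 1), F (d * hs N) := by
    intro N
    have key := hPD (N + 1) (fun i => (i : ℕ) * hs N)
      (fun i => Complex.exp ((((m : ℝ) * ((i : ℕ) * hs N) : ℝ) : ℂ) * Complex.I))
    -- evaluate the real part of the double sum
    have hterm : ∀ i j : Fin (N + 1),
        ((starRingEnd ℂ) (Complex.exp ((((m : ℝ) * ((i : ℕ) * hs N) : ℝ) : ℂ) * Complex.I)) *
            Complex.exp ((((m : ℝ) * ((j : ℕ) * hs N) : ℝ) : ℂ) * Complex.I) *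
            ((k ((j : ℕ) * hs N - (i : ℕ) * hs N) : ℝ) : ℂ)).re =
          F ((((j : ℕ) : ℝ) - (i : ℕ)) * hs N) := by
      intro i j
      rw [← Complex.exp_conj, map_mul, Complex.conj_ofReal, Complex.conj_I, mul_neg,
        ← Complex.exp_add, show -((((m : ℝ) * ((i : ℕ) * hs N) : ℝ) : ℂ) * Complex.I) +
          (((m : ℝ) * ((j : ℕ) * hs N) : ℝ) : ℂ) * Complex.I =
          (((m : ℝ) * ((((j : ℕ) : ℝ) - (i : ℕ)) * hs N) : ℝ) : ℂ) * Complex.I by push_cast; ring,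
        Complex.mul_re, Complex.exp_ofReal_mul_I_re, Complex.exp_ofReal_mul_I_im,
        Complex.ofReal_re, Complex.ofReal_im, mul_zero, sub_zero, hFdef]
      simp only
      rw [show ((j : ℕ) : ℝ) * hs N - (i : ℕ) * hs N = (((j : ℕ) : ℝ) - (i : ℕ)) * hs N by ring,
        mul_comm]
    rw [Complex.re_sum] at key
    simp_rw [Complex.re_sum, hterm] at key
    rw [sum_sum_sub_mul_eq_of_periodic (by rw [hNh N]; exact hFper)] at key
    -- `0 ≤ (N+1) Σ` gives `0 ≤ h Σ`
    have hS : 0 ≤ ∑ d ∈ Finset.range (N + 1), F (d * hs N) :=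
      nonneg_of_mul_nonneg_right (by rwa [mul_comm] at key) (by positivity)
    exact mul_nonneg (hhpos N).le hS
  -- the Riemann sums converge to the moment
  have hlim : Tendsto (fun N : ℕ => hs N * ∑ d ∈ Finset.range (N + 1), F (d * hs N)) atTop
      (𝓝 (∫ s in (0 : ℝ)..2 * π, F s)) := by
    refine Literature.Analysis.Asymptotics.tendsto_mul_sum_range_intervalIntegral hFc
      (N := fun N => N + 1) (by positivity) ?_ ?_
    · rw [tendsto_nhdsWithin_iff]
      refine ⟨?_, Eventually.of_forall fun N => hhpos N⟩
      have : Tendsto (fun N : ℕ => ((N + 1 : ℕ) : ℝ)) atTop atTop :=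
        tendsto_natCast_atTop_atTop.comp (tendsto_add_atTop_nat 1)
      simpa [hhs] using this.const_div_atTop (2 * π)
    · exact tendsto_const_nhds.congr fun N => (hNh N).symm
  exact ge_of_tendsto' hlim hRS

end Summit.QuantumFields.YangMills.Theorems

end
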